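import Mathlib
import HarnessLib
import Summits.HubbardSuperconductivity.HubbardSuperconductivity.Theorems.KLProgrammeKLRegimeOverlapWtColFlowDeep
import Summits.HubbardSuperconductivity.HubbardSuperconductivity.Theorems.KLProgrammeKLRegimeEngineWtTupleLineFromPlainWt
import Summits.HubbardSuperconductivity.HubbardSuperconductivity.Theorems.KLProgrammeKLRegimeEngineIsoResectorisationWt

/-!
# Route `KLProgramme` — crux K3 ENGINE (stmt-HubbardSuperconductivity-20437 `KLRegimeEngineV17F2`), row (b) `stub_engine_step_norms` (e78dfb33d2f7),
# producer hypotheses `hE4` (E-b3, `E4FlowAt`) and `hexI` (`IsoMomFlowAt`): the OSC-FREE «deep-window» suppliers of the weighted thin single character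
# sums at the top families, the osc-free (T3w), and THE TWO WITNESSES FROM ONE E1 PLAIN-LINE FAMILY — located item «(b)-E4/ISO-OSC-SLOT» and its cure
# (cell gate-hubbard-kl, seat p3 g24)

LOCATED (STATUS 2026-08-29 l.11245).  Row (b)'s conjuncts 3–4 are discharged only through the deferred packages `klE4Pack` (…V8DefsG8) / `klIsoMomPack`
(…V8IsoMomentRow), i.e. through witnesses of the OSC-FREE Props `E4FlowAt E u` / `IsoMomFlowAt E d u` (binders: `G, P, R, Q, cc`-doors, `μ`, `U ≤ u`, `β`,
`klEngL₃/M₃`, `1 ≤ n ≤ n_β+1`, `IsKLRegime`, `HistP`, `FrameOK` — NO `FlowPieceOscAt` rows).  The supplier route of record for `hE4` — (T3w)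
`wtTupleLineAt_of_wplainLine_klEng_flow_all` — and `isoFirstMomentsAt_of_wplainLine_klEng_flow_all` (p727978) both key on `charSumWt_klAniso_single_flow_all`,
whose binders carry the osc rows (an ADDED datum, not implied by `HistP`), so the composition `e4FlowAt_of_wtTupleLine (hline := (T3w) …)` is not typable.
CURE (supply side, registry-neutral): both witnesses read the thin family only at the TOP indices `J ∈ {n−1, n}` of the flow frame `K_n`, where the window
`4ⁿ·U ≤ 4^{2J+dd}` of the OSC-FREE deep route `charSumWt_nbWindow_klEng_flow_deep (dd)` (…OverlapWtColFlowDeep; order-three frame datum from `FrameOK`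
and the window) holds for free (`U ≤ 1/(Gfr₃+1) ≤ 1`, `dd = 2`):

* §1 **`charSumWt_klAniso_single_flow_deep`** — `∃ CT > 0`: under the osc-free binders of `charSumWt_nbWindow_klEng_flow_deep` (`R.WF2`, `0 < cc ≤ klEngC₃6`,
  `μ ∈ klWindowC`, `0 < U ≤ min (klEngU₀3 P R cc) (1/(Gfr₃+1))`, `klBetaMin ≤ β ≤ e^{cc/U²}`, `klEngL₃`, `klEngM₃`, `1 ≤ n ≤ n_β+1`, `HistP … 0 n`,
  `FrameOK … (K_n)`), for every `J j` with `1 ≤ J ≤ n ≤ J + 1` and `n ≤ j`: the rate-`Λ_j` weighted single character sum of `F_{J,ω}[K_n]` is `≤ CT·M·L²`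
  (nb pair `(J, J−1)` at rate `n` by the deep route, `→` any rate `j ≥ n` by `klScale_le_klScale`, `→` single by `charSumWt_klAniso_single_le`, factor `27`);
* §2 **`wtTupleLineAt_of_wplainLine_klEng_flow_deep`** — the osc-free (T3w): `∃ CW > 0`, same binders, for every `N₁ ≥ 0` bounding the `klScaleWt_n`-weighted PLAIN
  four-leg pinned sums of `𝒱_n[K_n]` at leg `0` (the `hplain` hypothesis of (T3w), verbatim) and `CW⁴·N₁ ≤ klE0·(a·(P.Klam·|U|) + b·(P.Klam·U)²)`:
  `WtTupleLineAt L M a b P β U μ (K_n) n`;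
* §3 **`e4FlowAt_of_wplainLine_flow_deep`** — THE `hE4` WITNESS, BY TYPE: if for an ABSOLUTE `a` and tables `bfun u₀` (`u₀ > 0`) the weighted plain line holds with
  `N₁ := klE0·(a·Klam|U| + bfun·(Klam U)²)/CW⁴` under `E4FlowAt`'s own binders and `U ≤ u₀ G P R Q cc`, then
  `∃ Eu, 0 ≤ Eu.1 ∧ (∀ G P R Q cc, 0 < Eu.2 G P R Q cc) ∧ E4FlowAt Eu.1 Eu.2` — the type of `hE4` in `A24a1G14.stub_engine_step_norms_of_E1rows`
  (`e4FlowAt_of_wtTupleLine` ∘ §2; threshold `u₀ ⊓ klEngU₀3 ⊓ 1/(Gfr₃+1) ⊓ …`);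
* §4 **`isoFirstMomentsAt_of_wplainLine_klEng_flow_deep`** — the osc-free twin of p727978 §6 (`2 ≤ n`, thin index `n − 1`): the `hexI` ROW from the same plain line
  `N₁` and the weighted iso(m) × thin(n−1) character sums `T m`.
So after this file `hE4` is, BY NAME, a consequence of ONE E1 hypothesis family — the U-currency `klScaleWt_n`-weighted plain quartic line of `𝒱_n[K_n]` under
`E4FlowAt`'s binders — and `hexI`'s row of that family plus the iso × thin data, with NO oscillation rows.  Everything is proved; no definitions; no E1 row and no
multiplier datum is produced; nothing asserts `hE4`, `hexI`, row (b), any stub of 20437, K3 or superconductivity.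
References: BGM 2006 §2.7 (2.66), (2.70)–(2.71a), §2.8 (2.76)–(2.77), (2.82)–(2.84), §3 (3.2)–(3.8) [cite: BenfattoGiulianiMastropietro2006].
-/

noncomputable section

namespace Summit.HubbardSuperconductivity.HubbardSuperconductivity.Theorems.EngineV8

set_option linter.dupNamespace false -- summit = problem name (single-conjunct summit), D-0017

open Classical
open Real Finset Literature.MathematicalPhysics.QuantumLattice Literature.Probability.LatticeModels GrassmannAlgebra
open Literature.Probability.LatticeModels.BattleFederbush
open Literature.MathematicalPhysics.QuantumLattice.FermiRG
open Summit.HubbardSuperconductivity.HubbardSuperconductivity.Theorems.KLProgrammeLegKernels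
open Summit.HubbardSuperconductivity.HubbardSuperconductivity.Theorems.KLRegimeSplit
open Summit.HubbardSuperconductivity.HubbardSuperconductivity.Theorems.TorusFourierL2
open Summit.HubbardSuperconductivity.HubbardSuperconductivity.Theorems.DispersionFlow

variable {L M : ℕ} [NeZero L] [NeZero M]

/-! ## §1 The osc-free weighted single character sums of the top thin families at the flow frame -/

/-- **OSC-FREE WEIGHTED SINGLE CHARACTER SUMS AT THE TOP FAMILIES** (`1 ≤ J ≤ n ≤ J + 1`, rate `j ≥ n`): `∃ CT > 0` such that, under the binders of
`charSumWt_nbWindow_klEng_flow_deep` (no `FlowPieceOscAt` rows, no regime clause), `Σ_z w_j(z)·‖S[F_{J,ω}[K_n]](z)‖ ≤ CT·M·L²` for every sector `ω`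
(`w_j(z) = 1 + (Λ_jβ/(2M))|z̃₀| + Λ_j|z̃₁| + Λ_j|z̃₂|`). [cite: BenfattoGiulianiMastropietro2006, §2.7 (2.66), (2.71a), §3 (3.3)] -/
theorem charSumWt_klAniso_single_flow_deep :
    ∃ CT : ℝ, 0 < CT ∧
      ∀ (G : GeoConsts) (P : SplitConsts) (R : RenConsts) (Q : EngConsts) (cc : ℝ), R.WF2 → 0 < cc → cc ≤ klEngC₃6 P R →
      ∀ μ ∈ klWindowC, ∀ U : ℝ, 0 < U → U ≤ min (klEngU₀3 P R cc) (1 / (R.Gfr 3 + 1)) →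
      ∀ β : ℝ, klBetaMin ≤ β → β ≤ Real.exp (cc / U ^ 2) →
      ∀ (L M : ℕ) [NeZero L] [NeZero M], klEngL₃ β U ≤ L → klEngM₃ β U L ≤ M →
      ∀ n : ℕ, 1 ≤ n → n ≤ nScales β + 1 →
        HistP klPredsV17F2 L M G P Q R β U μ 0 n → FrameOK R U (nScales β) μ (klFlowFrameU L M β U μ n) →
        ∀ J j : ℕ, 1 ≤ J → J ≤ n → n ≤ J + 1 → n ≤ j → ∀ ω : Fin (sectorCount J),
        ∑ z : TorusSite 1 (2 * M) × TorusSite 2 L,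
          (1 + klScale klE0 j * β / (2 * M) * |(((z.1 0).valMinAbs : ℤ) : ℝ)| + klScale klE0 j * |(((z.2 0).valMinAbs : ℤ) : ℝ)| +
              klScale klE0 j * |(((z.2 1).valMinAbs : ℤ) : ℝ)|) *
          ‖∑ q : TorusSite 1 (2 * M) × TorusSite 2 L, (torusChar q.1 z.1 * torusChar q.2 z.2) •
            klAnisoFamily L M β μ (klFlowFrameU L M β U μ n) klE0 J ω (⟨(q.1 0).val, ZMod.val_lt (q.1 0)⟩, q.2)‖ ≤ CT * M * (L : ℝ) ^ 2 := by
  obtain ⟨CT, hCT, h⟩ := charSumWt_nbWindow_klEng_flow_deep 2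
  refine ⟨27 * CT, by positivity, ?_⟩
  intro G P R Q cc hR2 hcc hcc6 μ hμ U hU hUle β hβmin hβc L M _ _ hL3 hM3 n hn1 hnN hhist hfr J j hJ1 hJn hnJ hnj ω
  have hβ0 : 0 < β := KLRegimeSplit.pos_of_klBetaMin_le hβmin
  have hM0 : (0 : ℝ) < M := Nat.cast_pos.2 (Nat.pos_of_ne_zero (NeZero.ne M))
  have hT0 : 0 ≤ CT * M * (L : ℝ) ^ 2 := by positivity
  have hG3 : 0 ≤ R.Gfr 3 := gfr_nonneg_of_wf2 hR2 3
  have hU1 : U ≤ 1 := by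
    refine (hUle.trans (min_le_right _ _)).trans ?_
    rw [div_le_one (by positivity)]
    linarith
  -- the deep window at the pair (k + 1, J′) = (J, n), dd = 2: `n ≤ J + 2`
  have hwin : (4 : ℝ) ^ n * U ≤ (4 : ℝ) ^ (2 * (J - 1 + 1) + 2) := pow_window_overlap_of_nat_window hU1 (by omega)
  have hnb := h G P R Q cc hR2 hcc hcc6 μ hμ U hU hUle β hβmin hβc L M hL3 hM3 n hn1 hnN hhist hfr (J - 1) n (by omega) le_rfl hwin J (by omega) hJn ω
  -- rate `n` ⟶ rate `j ≥ n` (the weight decreases), then single from the neighbouring pair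
  have hΛ0 : 0 ≤ klScale klE0 j := (klth_klScale_pos j).le
  have hΛle : klScale klE0 j ≤ klScale klE0 n := klScale_le_klScale (by norm_num [klE0]) hnj
  have hnb' : ∀ a' : Fin (sectorCount (J - 1)), ∑ z : TorusSite 1 (2 * M) × TorusSite 2 L,
      (1 + klScale klE0 j * β / (2 * M) * |(((z.1 0).valMinAbs : ℤ) : ℝ)| + klScale klE0 j * |(((z.2 0).valMinAbs : ℤ) : ℝ)| +
          klScale klE0 j * |(((z.2 1).valMinAbs : ℤ) : ℝ)|) *
      ‖∑ q : TorusSite 1 (2 * M) × TorusSite 2 L, (torusChar q.1 z.1 * torusChar q.2 z.2) •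
        (klAnisoFamily L M β μ (klFlowFrameU L M β U μ n) klE0 J ω (⟨(q.1 0).val, ZMod.val_lt (q.1 0)⟩, q.2) *
          klAnisoFamily L M β μ (klFlowFrameU L M β U μ n) klE0 (J - 1) a' (⟨(q.1 0).val, ZMod.val_lt (q.1 0)⟩, q.2))‖ ≤ CT * M * (L : ℝ) ^ 2 := by
    intro a'
    refine le_trans (sum_le_sum fun z _ => mul_le_mul_of_nonneg_right ?_ (norm_nonneg _)) (hnb a')
    have h0 : 0 ≤ |(((z.1 0).valMinAbs : ℤ) : ℝ)| := abs_nonneg _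
    have h1 : 0 ≤ |(((z.2 0).valMinAbs : ℤ) : ℝ)| := abs_nonneg _
    have h2 : 0 ≤ |(((z.2 1).valMinAbs : ℤ) : ℝ)| := abs_nonneg _
    have hb : klScale klE0 j * β / (2 * M) ≤ klScale klE0 n * β / (2 * M) :=
      div_le_div_of_nonneg_right (mul_le_mul_of_nonneg_right hΛle hβ0.le) (by positivity)
    nlinarith [mul_le_mul_of_nonneg_right hΛle h1, mul_le_mul_of_nonneg_right hΛle h2, mul_le_mul_of_nonneg_right hb h0]
  have hs := charSumWt_klAniso_single_le β μ (klFlowFrameU L M β U μ n) (a := klScale klE0 j * β / (2 * M)) (b := klScale klE0 j)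
    (by positivity) hΛ0 hJ1 ω hT0 hnb'
  refine hs.trans (le_of_eq ?_)
  ring

/-! ## §2 The osc-free (T3w): E-b3's left side / `WtTupleLineAt` from the weighted plain four-leg line -/

/-- **THE E-b3 LEFT SIDE FROM THE WEIGHTED PLAIN FOUR-LEG LINE, OSC-FREE** (twin of `wtTupleLine_le_of_wplainLine_klEng_flow_all` on §1 at `(J, j) = (n, n)`):
`∃ CW > 0` such that, under the osc-free binders, for every `N₁ ≥ 0` bounding the `klScaleWt_n`-weighted plain four-leg pinned sums of `𝒱_n[K_n]` at leg `0` and every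
anisotropic 4-tuple `Ω`: the E-b3 left side is `≤ CW⁴·N₁`. [cite: BenfattoGiulianiMastropietro2006, §2.7 (2.70)-(2.71a), §2.8 (2.82)-(2.84)] -/
theorem wtTupleLine_le_of_wplainLine_klEng_flow_deep :
    ∃ CW : ℝ, 0 < CW ∧
      ∀ (G : GeoConsts) (P : SplitConsts) (R : RenConsts) (Q : EngConsts) (cc : ℝ), R.WF2 → 0 < cc → cc ≤ klEngC₃6 P R →
      ∀ μ ∈ klWindowC, ∀ U : ℝ, 0 < U → U ≤ min (klEngU₀3 P R cc) (1 / (R.Gfr 3 + 1)) →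
      ∀ β : ℝ, klBetaMin ≤ β → β ≤ Real.exp (cc / U ^ 2) →
      ∀ (L M : ℕ) [NeZero L] [NeZero M], klEngL₃ β U ≤ L → klEngM₃ β U L ≤ M →
      ∀ n : ℕ, 1 ≤ n → n ≤ nScales β + 1 →
        HistP klPredsV17F2 L M G P Q R β U μ 0 n → FrameOK R U (nScales β) μ (klFlowFrameU L M β U μ n) →
        ∀ N₁ : ℝ, 0 ≤ N₁ →
          (∀ (τ' : Fin 4 → SectorLeg 1) (y : SpaceTimeIdx L M),
            imagTimeWeight β M ^ 3 * ∑ x' ∈ univ.filter (fun x' : Fin 4 → SpaceTimeIdx L M => x' 0 = y),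
              klScaleWt L M β n ((univ.image x').image (fun x : SpaceTimeIdx L M => (((((2 * (x.1 : ℕ) : ℕ)) : ZMod (2 * (2 * M)))), x.2))) *
                ‖sectorisedKernel L M β (trivialMultiplier L M)
                  (klEffectiveAction L M β U μ (klFlowFrameU L M β U μ n) klE0 n) 4 τ' x'‖ ≤ N₁) →
          ∀ Ω : Fin 4 → SectorLeg (sectorCount n),
            imagTimeWeight β M ^ 3 *
                ∑ x : Fin 3 → SpaceTimeIdx L M,
                  klScaleWt L M β n ((univ.image (fun j : Fin 4 => (Matrix.vecCons (0 : SpaceTimeIdx L M) x j, Ω j))).image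
                      (latticeLegPos (2 * (2 * M)))) *
                    ‖klAnisoLegKernel L M β U μ (klFlowFrameU L M β U μ n) klE0 n 4 Ω (Matrix.vecCons (0 : SpaceTimeIdx L M) x)‖ ≤
              CW ^ 4 * N₁ := by
  obtain ⟨CT, hCT, hT⟩ := charSumWt_klAniso_single_flow_deep
  refine ⟨CT / 2, by positivity, ?_⟩
  intro G P R Q cc hR2 hcc hcc6 μ hμ U hU hUle β hβmin hβc L M _ _ hL3 hM3 n hn1 hnN hhist hfr N₁ hN₁0 hplain Ω
  have hβ0 : 0 < β := KLRegimeSplit.pos_of_klBetaMin_le hβmin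
  have hM0 : (0 : ℝ) < M := Nat.cast_pos.2 (Nat.pos_of_ne_zero (NeZero.ne M))
  have hL0 : (0 : ℝ) < L := Nat.cast_pos.2 (Nat.pos_of_ne_zero (NeZero.ne L))
  set K : TrigPolyC4v := klFlowFrameU L M β U μ n with hK
  set 𝒱 : HubbardGrassmann L M := klEffectiveAction L M β U μ K klE0 n with h𝒱
  set gpos : SpaceTimeIdx L M → ZMod (2 * (2 * M)) × TorusSite 2 L :=
    fun x => (((((2 * (x.1 : ℕ) : ℕ)) : ZMod (2 * (2 * M)))), x.2) with hgpos
  have hT₁ := fun ω => hT G P R Q cc hR2 hcc hcc6 μ hμ U hU hUle β hβmin hβc L M hL3 hM3 n hn1 hnN hhist hfr n n hn1 le_rfl (Nat.le_succ n) le_rfl ω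
  have hc0 : 0 ≤ CT * M * (L : ℝ) ^ 2 / (β * (L : ℝ) ^ 2) := by positivity
  obtain ⟨hrowS, hcolS⟩ := transferSumsWt_klAniso_single_le hβ0 μ K n n hT₁
  have hwt : IsTreeWeight (klScaleWt L M β n) := isTreeWeight_klScaleWt L M hβ0.le n
  have hline := wprescribedSum_klAniso_le_of_plain_treeWt hwt gpos hβ0 μ K n 𝒱 hc0 hc0 hN₁0
    (fun ω'' σ' c x' => hcolS ω'' σ' c x') (fun ω'' σ' c x'' => hrowS ω'' σ' c x'') 3 Ω 0 hplain 0
  have hsum : ∑ x : Fin 3 → SpaceTimeIdx L M,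
      klScaleWt L M β n ((univ.image (fun j : Fin 4 => (Matrix.vecCons (0 : SpaceTimeIdx L M) x j, Ω j))).image (latticeLegPos (2 * (2 * M)))) *
        ‖klAnisoLegKernel L M β U μ K klE0 n 4 Ω (Matrix.vecCons (0 : SpaceTimeIdx L M) x)‖ =
      ∑ x'' ∈ univ.filter (fun x'' : Fin 4 → SpaceTimeIdx L M => x'' 0 = 0),
        klScaleWt L M β n ((univ.image x'').image gpos) * ‖sectorisedKernel L M β (klAnisoFamily L M β μ K klE0 n) 𝒱 4 Ω x''‖ := by
    rw [sum_filter_apply_eq]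
    refine sum_congr rfl fun x _ => ?_
    rw [Fin.insertNth_zero']
    have hw : (univ.image (fun j : Fin 4 => (Matrix.vecCons (0 : SpaceTimeIdx L M) x j, Ω j))).image (latticeLegPos (2 * (2 * M))) =
        (univ.image (Fin.cons (0 : SpaceTimeIdx L M) x : Fin 4 → SpaceTimeIdx L M)).image gpos := by
      rw [image_latticeLegPos_eq_image_pos]
      rfl
    rw [hw]
    rfl
  rw [hsum]
  refine hline.trans (le_of_eq ?_)
  have hq : CT * M * (L : ℝ) ^ 2 / (β * (L : ℝ) ^ 2) * imagTimeWeight β M = CT / 2 := by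
    unfold imagTimeWeight
    field_simp
  calc (CT * M * (L : ℝ) ^ 2 / (β * (L : ℝ) ^ 2)) ^ 3 * (CT * M * (L : ℝ) ^ 2 / (β * (L : ℝ) ^ 2)) * imagTimeWeight β M ^ (3 + 1) * N₁
      = (CT * M * (L : ℝ) ^ 2 / (β * (L : ℝ) ^ 2) * imagTimeWeight β M) ^ 4 * N₁ := by ring
    _ = (CT / 2) ^ 4 * N₁ := by rw [hq]

/-- **`WtTupleLineAt` AT THE FLOW FRAME FROM THE WEIGHTED PLAIN LINE, OSC-FREE** (twin of `wtTupleLineAt_of_wplainLine_klEng_flow_all`): with `CW` of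
`wtTupleLine_le_of_wplainLine_klEng_flow_deep`, if the weighted plain pinned sums are `≤ N₁` and `CW⁴·N₁ ≤ klE0·(a·(P.Klam·|U|) + b·(P.Klam·U)²)`, then
`WtTupleLineAt L M a b P β U μ (klFlowFrameU L M β U μ n) n`. [cite: BenfattoGiulianiMastropietro2006, §2.8 (2.76)-(2.77)] -/
theorem wtTupleLineAt_of_wplainLine_klEng_flow_deep :
    ∃ CW : ℝ, 0 < CW ∧
      ∀ (G : GeoConsts) (P : SplitConsts) (R : RenConsts) (Q : EngConsts) (cc : ℝ), R.WF2 → 0 < cc → cc ≤ klEngC₃6 P R →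
      ∀ μ ∈ klWindowC, ∀ U : ℝ, 0 < U → U ≤ min (klEngU₀3 P R cc) (1 / (R.Gfr 3 + 1)) →
      ∀ β : ℝ, klBetaMin ≤ β → β ≤ Real.exp (cc / U ^ 2) →
      ∀ (L M : ℕ) [NeZero L] [NeZero M], klEngL₃ β U ≤ L → klEngM₃ β U L ≤ M →
      ∀ n : ℕ, 1 ≤ n → n ≤ nScales β + 1 →
        HistP klPredsV17F2 L M G P Q R β U μ 0 n → FrameOK R U (nScales β) μ (klFlowFrameU L M β U μ n) →
        ∀ N₁ : ℝ, 0 ≤ N₁ →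
          (∀ (τ' : Fin 4 → SectorLeg 1) (y : SpaceTimeIdx L M),
            imagTimeWeight β M ^ 3 * ∑ x' ∈ univ.filter (fun x' : Fin 4 → SpaceTimeIdx L M => x' 0 = y),
              klScaleWt L M β n ((univ.image x').image (fun x : SpaceTimeIdx L M => (((((2 * (x.1 : ℕ) : ℕ)) : ZMod (2 * (2 * M)))), x.2))) *
                ‖sectorisedKernel L M β (trivialMultiplier L M)
                  (klEffectiveAction L M β U μ (klFlowFrameU L M β U μ n) klE0 n) 4 τ' x'‖ ≤ N₁) →
          ∀ a b : ℝ, CW ^ 4 * N₁ ≤ klE0 * (a * (P.Klam * |U|) + b * (P.Klam * U) ^ 2) →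
            WtTupleLineAt L M a b P β U μ (klFlowFrameU L M β U μ n) n := by
  obtain ⟨CW, hCW, h⟩ := wtTupleLine_le_of_wplainLine_klEng_flow_deep
  refine ⟨CW, hCW, ?_⟩
  intro G P R Q cc hR2 hcc hcc6 μ hμ U hU hUle β hβmin hβc L M _ _ hL3 hM3 n hn1 hnN hhist hfr N₁ hN₁0 hplain a b hab Ω
  exact (h G P R Q cc hR2 hcc hcc6 μ hμ U hU hUle β hβmin hβc L M hL3 hM3 n hn1 hnN hhist hfr N₁ hN₁0 hplain Ω).trans hab

/-! ## §3 THE `hE4` WITNESS FROM ONE E1 PLAIN-LINE FAMILY (osc-free, `E4FlowAt`'s own binders) -/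

/-- **THE (E4) FIRST-MOMENTS WITNESS OF ROW (b) FROM THE WEIGHTED PLAIN FOUR-LEG LINE — BY TYPE.**  If for an ABSOLUTE `a ≥ 0`, a table `bfun ≥ 0` and the
producer's own door `u₀ > 0`, the `klScaleWt_n`-weighted PLAIN four-leg pinned sums of `𝒱_n[K_n]` at leg `0` are `≤ klE0·(a·|U| + bfun·(P.Klam·U)²)` under EXACTLY
the binders of `E4FlowAt` (well-formed `G P R Q`, `0 < cc ≤ klEngC₃6 P R`, `μ ∈ klWindowC`, `0 < U ≤ u₀ G P R Q cc`, the `β`-window, `klEngL₃/M₃`, `1 ≤ n ≤ n_β+1`,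
`IsKLRegime`, `HistP … 0 n`, `FrameOK … (K_n)` — NO oscillation rows), then `∃ Eu, 0 ≤ Eu.1 ∧ (∀ G P R Q cc, 0 < Eu.2 G P R Q cc) ∧ E4FlowAt Eu.1 Eu.2` — the type
of `hE4` in `A24a1G14.stub_engine_step_norms_of_E1rows` (p727075): `e4FlowAt_of_wtTupleLine` ∘ `wtTupleLineAt_of_wplainLine_klEng_flow_deep`, threshold
`u₀ ⊓ klEngU₀3 ⊓ 1/(|Gfr₃|+1) ⊓ E/(2(|CW⁴·bfun|·Klam + 1))`, `E = 2·max (CW⁴·a) 1`; the Klam-free leading term serves by `1 ≤ P.Klam`.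
[cite: BenfattoGiulianiMastropietro2006, §2.7 (2.70)-(2.71a), §2.8 (2.76)-(2.77), §3 (3.2)-(3.8)] -/
theorem e4FlowAt_of_wplainLine_flow_deep {a : ℝ} (ha : 0 ≤ a) {bfun u₀ : GeoConsts → SplitConsts → RenConsts → EngConsts → ℝ → ℝ}
    (hb : ∀ G P R Q cc, 0 ≤ bfun G P R Q cc) (hu₀ : ∀ G P R Q cc, 0 < u₀ G P R Q cc)
    (hplain : ∀ (G : GeoConsts), G.WF → ∀ (P : SplitConsts) (R : RenConsts) (Q : EngConsts) (cc : ℝ), P.WF → R.WF2 → Q.WF → 0 < cc →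
      cc ≤ klEngC₃6 P R → ∀ μ ∈ klWindowC, ∀ U : ℝ, 0 < U → U ≤ u₀ G P R Q cc →
      ∀ β : ℝ, klBetaMin ≤ β → β ≤ Real.exp (cc / U ^ 2) →
      ∀ (L M : ℕ) [NeZero L] [NeZero M], klEngL₃ β U ≤ L → klEngM₃ β U L ≤ M →
      ∀ n : ℕ, 1 ≤ n → n ≤ nScales β + 1 → IsKLRegime U cc (-(n : ℤ)) →
        HistP klPredsV17F2 L M G P Q R β U μ 0 n → FrameOK R U (nScales β) μ (klFlowFrameU L M β U μ n) →
        ∀ (τ' : Fin 4 → SectorLeg 1) (y : SpaceTimeIdx L M),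
          imagTimeWeight β M ^ 3 * ∑ x' ∈ univ.filter (fun x' : Fin 4 → SpaceTimeIdx L M => x' 0 = y),
            klScaleWt L M β n ((univ.image x').image (fun x : SpaceTimeIdx L M => (((((2 * (x.1 : ℕ) : ℕ)) : ZMod (2 * (2 * M)))), x.2))) *
              ‖sectorisedKernel L M β (trivialMultiplier L M)
                (klEffectiveAction L M β U μ (klFlowFrameU L M β U μ n) klE0 n) 4 τ' x'‖ ≤
          klE0 * (a * |U| + bfun G P R Q cc * (P.Klam * U) ^ 2)) :
    ∃ Eu : ℝ × (GeoConsts → SplitConsts → RenConsts → EngConsts → ℝ → ℝ),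
      0 ≤ Eu.1 ∧ (∀ G P R Q cc, 0 < Eu.2 G P R Q cc) ∧ E4FlowAt Eu.1 Eu.2 := by
  obtain ⟨CW, hCW, hT⟩ := wtTupleLineAt_of_wplainLine_klEng_flow_deep
  have he : (0 : ℝ) < klE0 := by norm_num [klE0]
  set u₁ : GeoConsts → SplitConsts → RenConsts → EngConsts → ℝ → ℝ :=
    fun G P R Q cc => min (u₀ G P R Q cc) (min (klEngU₀3 P R cc) (1 / (|R.Gfr 3| + 1))) with hu₁
  have hu₁pos : ∀ G P R Q cc, 0 < u₁ G P R Q cc := fun G P R Q cc =>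
    lt_min (hu₀ G P R Q cc) (lt_min (klEngU₀3_pos P R cc) (by positivity))
  have hline : ∀ (G : GeoConsts), G.WF → ∀ (P : SplitConsts) (R : RenConsts) (Q : EngConsts) (cc : ℝ), P.WF → R.WF2 → Q.WF → 0 < cc →
      cc ≤ klEngC₃6 P R → ∀ μ ∈ klWindowC, ∀ U : ℝ, 0 < U → U ≤ u₁ G P R Q cc →
      ∀ β : ℝ, klBetaMin ≤ β → β ≤ Real.exp (cc / U ^ 2) →
      ∀ (L M : ℕ) [NeZero L] [NeZero M], klEngL₃ β U ≤ L → klEngM₃ β U L ≤ M →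
      ∀ n : ℕ, 1 ≤ n → n ≤ nScales β + 1 → IsKLRegime U cc (-(n : ℤ)) →
        HistP klPredsV17F2 L M G P Q R β U μ 0 n → FrameOK R U (nScales β) μ (klFlowFrameU L M β U μ n) →
          WtTupleLineAt L M (CW ^ 4 * a) (CW ^ 4 * bfun G P R Q cc) P β U μ (klFlowFrameU L M β U μ n) n := by
    intro G hG P R Q cc hP hR hQ hcc hcc6 μ hμ U hU hUu β hβ hβc L M _ _ hL hM n hn1 hn hreg hhist hfr
    have hU0 : U ≤ u₀ G P R Q cc := hUu.trans (min_le_left _ _)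
    have h3 : 0 ≤ R.Gfr 3 := gfr_nonneg_of_wf2 hR 3
    have hUle : U ≤ min (klEngU₀3 P R cc) (1 / (R.Gfr 3 + 1)) := by
      have h := hUu.trans (min_le_right _ _)
      rwa [abs_of_nonneg h3] at h
    have hK : 1 ≤ P.Klam := hP.1
    have hN₁0 : 0 ≤ klE0 * (a * |U| + bfun G P R Q cc * (P.Klam * U) ^ 2) := by
      have := hb G P R Q cc
      positivity
    refine hT G P R Q cc hR hcc hcc6 μ hμ U hU hUle β hβ hβc L M hL hM n hn1 hn hhist hfr _ hN₁0
      (hplain G hG P R Q cc hP hR hQ hcc hcc6 μ hμ U hU hU0 β hβ hβc L M hL hM n hn1 hn hreg hhist hfr) _ _ ?_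
    -- `CW⁴·klE0·(a|U| + b(Klam U)²) ≤ klE0·(CW⁴a·(Klam|U|) + CW⁴b·(Klam U)²)` since `|U| ≤ Klam·|U|` (`1 ≤ Klam`)
    have h1 : a * |U| ≤ a * (P.Klam * |U|) := mul_le_mul_of_nonneg_left (le_mul_of_one_le_left (abs_nonneg U) hK) ha
    have h2 : 0 ≤ klE0 * CW ^ 4 := mul_nonneg he.le (pow_nonneg hCW.le 4)
    nlinarith [mul_le_mul_of_nonneg_left h1 h2]
  exact ⟨(2 * max (CW ^ 4 * a) 1, fun G P R Q cc => min (u₁ G P R Q cc) ((2 * max (CW ^ 4 * a) 1) / (2 * (|CW ^ 4 * bfun G P R Q cc| * |P.Klam| + 1)))),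
    by positivity, fun G P R Q cc => e4Threshold_pos (hu₁pos G P R Q cc) (by positivity), e4FlowAt_of_wtTupleLine hline⟩

/-! ## §4 The osc-free twin of `isoFirstMomentsAt_of_wplainLine_klEng_flow_all`: `hexI`'s ROW from the same plain line and the iso × thin data -/

/-- **`IsoFirstMomentsAt` FROM THE WEIGHTED PLAIN FOUR-LEG LINE, OSC-FREE** (`2 ≤ n`; thin index `n − 1`): `∃ CW > 0` such that, under the osc-free binders of §1,
for every `N₁ ≥ 0` bounding the `klScaleWt_n`-weighted plain four-leg pinned sums of `𝒱_n[K_n]` at leg `0`, every `T m ≥ 0` bounding the weighted iso(m) × thin(n−1)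
character sums at rate `Λ_m` (`n ≤ m ≤ n_β`) and every `cM, cM′` with `(3·T m/(βL²))⁴·27⁴·ε⁴·(CW⁴·N₁) ≤ cM·|U| + cM′·(P.Klam·U)²`: `IsoFirstMomentsAt L M cM cM′ P β U μ n`
(`isoFirstMomentsAt_of_wtAnisoLines_rate` fed by §1 at `(J, j) = (n−1, n)`). [cite: BenfattoGiulianiMastropietro2006, §2.7 (2.70)-(2.71a), §2.8 (2.76)-(2.84), §3 (3.5)-(3.6)] -/
theorem isoFirstMomentsAt_of_wplainLine_klEng_flow_deep :
    ∃ CW : ℝ, 0 < CW ∧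
      ∀ (G : GeoConsts) (P : SplitConsts) (R : RenConsts) (Q : EngConsts) (cc : ℝ), R.WF2 → 0 < cc → cc ≤ klEngC₃6 P R →
      ∀ μ ∈ klWindowC, ∀ U : ℝ, 0 < U → U ≤ min (klEngU₀3 P R cc) (1 / (R.Gfr 3 + 1)) →
      ∀ β : ℝ, klBetaMin ≤ β → β ≤ Real.exp (cc / U ^ 2) →
      ∀ (L M : ℕ) [NeZero L] [NeZero M], klEngL₃ β U ≤ L → klEngM₃ β U L ≤ M →
      ∀ n : ℕ, 2 ≤ n → n ≤ nScales β + 1 →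
        HistP klPredsV17F2 L M G P Q R β U μ 0 n → FrameOK R U (nScales β) μ (klFlowFrameU L M β U μ n) →
        ∀ N₁ : ℝ, 0 ≤ N₁ →
          (∀ (τ' : Fin 4 → SectorLeg 1) (y : SpaceTimeIdx L M),
            imagTimeWeight β M ^ 3 * ∑ x' ∈ univ.filter (fun x' : Fin 4 → SpaceTimeIdx L M => x' 0 = y),
              klScaleWt L M β n ((univ.image x').image (fun x : SpaceTimeIdx L M => (((((2 * (x.1 : ℕ) : ℕ)) : ZMod (2 * (2 * M)))), x.2))) *
                ‖sectorisedKernel L M β (trivialMultiplier L M)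
                  (klEffectiveAction L M β U μ (klFlowFrameU L M β U μ n) klE0 n) 4 τ' x'‖ ≤ N₁) →
          ∀ T : ℕ → ℝ, (∀ m, 0 ≤ T m) →
          (∀ m, n ≤ m → m ≤ nScales β → ∀ (σ : Fin (sectorCount (2 * m))) (a' : Fin (sectorCount (n - 1))),
            ∑ z : TorusSite 1 (2 * M) × TorusSite 2 L,
              (1 + klScale klE0 m * β / (2 * M) * |(((z.1 0).valMinAbs : ℤ) : ℝ)| + klScale klE0 m * |(((z.2 0).valMinAbs : ℤ) : ℝ)| +
                  klScale klE0 m * |(((z.2 1).valMinAbs : ℤ) : ℝ)|) *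
              ‖∑ q : TorusSite 1 (2 * M) × TorusSite 2 L, (torusChar q.1 z.1 * torusChar q.2 z.2) •
                (klIsoFamily L M β μ (klFlowFrameU L M β U μ n) klE0 m σ (⟨(q.1 0).val, ZMod.val_lt (q.1 0)⟩, q.2) *
                  klAnisoFamily L M β μ (klFlowFrameU L M β U μ n) klE0 (n - 1) a' (⟨(q.1 0).val, ZMod.val_lt (q.1 0)⟩, q.2))‖ ≤ T m) →
          ∀ cM cM' : ℝ,
          (∀ m, n ≤ m → m ≤ nScales β →
            (3 * T m / (β * (L : ℝ) ^ 2)) ^ 3 * (3 * T m / (β * (L : ℝ) ^ 2)) * 27 ^ 4 * imagTimeWeight β M ^ 3 *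
              (imagTimeWeight β M * (CW ^ 4 * N₁)) ≤ cM * |U| + cM' * (P.Klam * U) ^ 2) →
            IsoFirstMomentsAt L M cM cM' P β U μ n := by
  obtain ⟨CT, hCT, hT⟩ := charSumWt_klAniso_single_flow_deep
  refine ⟨CT / 2, by positivity, ?_⟩
  intro G P R Q cc hR2 hcc hcc6 μ hμ U hU hUle β hβmin hβc L M _ _ hL3 hM3 n hn2 hnN hhist hfr N₁ hN₁0 hplain Tm hTm0 hiso cM cM' hfit
  have hn1 : 1 ≤ n := le_trans (by norm_num) hn2
  have hβ0 : 0 < β := KLRegimeSplit.pos_of_klBetaMin_le hβmin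
  have hM0 : (0 : ℝ) < M := Nat.cast_pos.2 (Nat.pos_of_ne_zero (NeZero.ne M))
  have hL0 : (0 : ℝ) < L := Nat.cast_pos.2 (Nat.pos_of_ne_zero (NeZero.ne L))
  set K : TrigPolyC4v := klFlowFrameU L M β U μ n with hK
  set 𝒱 : HubbardGrassmann L M := klEffectiveAction L M β U μ K klE0 n with h𝒱
  set gpos : SpaceTimeIdx L M → ZMod (2 * (2 * M)) × TorusSite 2 L :=
    fun x => (((((2 * (x.1 : ℕ) : ℕ)) : ZMod (2 * (2 * M)))), x.2) with hgpos
  -- the osc-free weighted single character sums of the THIN family of index `n − 1`, rate `n`, at the flow frame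
  have hT₁ := fun ω => hT G P R Q cc hR2 hcc hcc6 μ hμ U hU hUle β hβmin hβc L M hL3 hM3 n hn1 hnN hhist hfr (n - 1) n
    (by omega) (Nat.sub_le n 1) (by omega) le_rfl ω
  have hc0 : 0 ≤ CT * M * (L : ℝ) ^ 2 / (β * (L : ℝ) ^ 2) := by positivity
  obtain ⟨hrowS, hcolS⟩ := transferSumsWt_klAniso_single_le hβ0 μ K (n - 1) n hT₁
  have hwt : IsTreeWeight (klScaleWt L M β n) := isTreeWeight_klScaleWt L M hβ0.le n
  have hq : CT * M * (L : ℝ) ^ 2 / (β * (L : ℝ) ^ 2) * imagTimeWeight β M = CT / 2 := by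
    unfold imagTimeWeight
    field_simp
  have hBF : ∀ (σ' : Fin 4 → SectorLeg (sectorCount (n - 1))) (y : SpaceTimeIdx L M),
      imagTimeWeight β M ^ 3 * ∑ x' ∈ univ.filter (fun x' : Fin 4 → SpaceTimeIdx L M => x' 0 = y),
        klScaleWt L M β n ((univ.image x').image gpos) * ‖klAnisoKernelAt L M β U μ K n (n - 1) σ' x'‖ ≤ (CT / 2) ^ 4 * N₁ := by
    intro σ' y
    have hline := wprescribedSum_klAniso_le_of_plain_treeWt hwt gpos hβ0 μ K (n - 1) 𝒱 hc0 hc0 hN₁0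
      (fun ω'' s c x' => hcolS ω'' s c x') (fun ω'' s c x'' => hrowS ω'' s c x'') 3 σ' 0 hplain y
    refine hline.trans (le_of_eq ?_)
    calc (CT * M * (L : ℝ) ^ 2 / (β * (L : ℝ) ^ 2)) ^ 3 * (CT * M * (L : ℝ) ^ 2 / (β * (L : ℝ) ^ 2)) * imagTimeWeight β M ^ (3 + 1) * N₁
        = (CT * M * (L : ℝ) ^ 2 / (β * (L : ℝ) ^ 2) * imagTimeWeight β M) ^ 4 * N₁ := by ring
      _ = (CT / 2) ^ 4 * N₁ := by rw [hq]
  exact isoFirstMomentsAt_of_wtAnisoLines_rate hβ0 U μ P n (n₂ := n - 1) (by omega) hTm0 (by positivity) hiso hBF hfit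

end Summit.HubbardSuperconductivity.HubbardSuperconductivity.Theorems.EngineV8

end
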